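import Summits.AtomisticToContinuum.Crystallization.Theorems.FrustratedLawDichotomyStrainedPatchHomLeafTableSoundB

/-!
# v2 leaf checker — SOUNDNESS of `leafCheck` (assembly against `…HomLeafPoints.leaf_sound_points`)

decomp-a2c hand-1 g20 (crux `AperiodicFrustratedLawGap`, stmt-AtomisticToContinuum-27623; critic row 806 (2)(C)).  ★★★ `leafCheck_sound`: if the table
is certified (`tab.allOK E`), the label records are consistent (`NL.ok`), lie in `[−7,7]³∖0`, carry pairwise distinct labels, have class sums ≤ `Aⱼ`,
and `leafCheck tab labs E A… nstop g sμ aμ = true`, then for every deformation `G` whose frame Gram data lie in the box `g` and for which (i) every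
box label not represented (up to sign) in the list is far and (ii) every list label beyond the stop is far:
`±aμ/SC ≤ Σ_{b ∈ [−7,7]³∖0} W₄₅ ‖latPt G fccVec b‖` — the `hleaf` floor input of `…HomCover.homFloor_of_entryCover`.  Small proof-side definitions
(`NL.toLab`, `GB.cz/wz`, `rowT`); 0 sorry; standard axioms.  `--supports stmt-AtomisticToContinuum-27623`.
-/

noncomputable section

namespace Summit.AtomisticToContinuum.Crystallization.Theorems.FrustratedLawDichotomyStrainedPatchHomLeafTableCheck

open scoped BigOperators RealInnerProductSpace
open Set
open Literature.Analysis.ValidatedNumerics.Numerics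
open Summit.AtomisticToContinuum.Crystallization.Theorems.ChargedEnergyGapNegative (E3)
open Summit.AtomisticToContinuum.Crystallization.Theorems.FrustratedLawDichotomySchurCut (effPot w₄₅ ω₄)
open Summit.AtomisticToContinuum.Crystallization.Theorems.FrustratedLawDichotomyStrainedPatchHomSplit (latPt)
open Summit.AtomisticToContinuum.Crystallization.Theorems.FrustratedLawDichotomyStrainedPatchHomCentredForm (linear_mem_Icc_of_box)
open Summit.AtomisticToContinuum.Crystallization.Theorems.FrustratedLawDichotomyStrainedPatchHomGram (summand_eq_gram norm_sq_latPt_eq_sum_gram)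
open Summit.AtomisticToContinuum.Crystallization.Theorems.FrustratedLawDichotomyStrainedPatchHomTermCalculus (hasDerivAt_phi45 effPot45_eq_far)
open Summit.AtomisticToContinuum.Crystallization.Theorems.FrustratedLawDichotomyStrainedPatchHomLeafPoints

/-! ## §5. ★★★ Soundness of the leaf check -/

/-- ★★★ **SOUNDNESS OF THE v2 LEAF CHECK.**  See the module docstring. [folklore] -/
theorem leafCheck_sound {tab : QT} {labs : List NL} {E A0 A1 A2 A3 A4 A5 nstop : ℕ} {g : GB} {sμ : Bool} {aμ : ℕ}
    (htab : tab.allOK E = true) (hok : ∀ l ∈ labs, l.ok = true)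
    (hbox7 : ∀ l ∈ labs, l.toLab ∈ (Fintype.piFinset fun _ : Fin 3 => Finset.Icc (-7 : ℤ) 7).filter (fun b => b ≠ 0))
    (hcanon : ∀ l ∈ labs, ∀ l' ∈ labs, l.toLab ≠ -l'.toLab) (hnd : (labs.map NL.toLab).Nodup)
    (hA : (labs.map NL.m00).sum ≤ A0 ∧ (labs.map NL.m11).sum ≤ A1 ∧ (labs.map NL.m22).sum ≤ A2 ∧ (labs.map NL.m01).sum ≤ A3 ∧
      (labs.map NL.m02).sum ≤ A4 ∧ (labs.map NL.m12).sum ≤ A5)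
    (h : leafCheck tab labs E A0 A1 A2 A3 A4 A5 nstop g sμ aμ = true) (f : Fin 3 → E3) (G : E3 →L[ℝ] E3)
    (hbox : ∀ i j : Fin 3, |⟪G (f i), G (f j)⟫ - ((g.cz i j : ℤ) : ℝ) / SC| ≤ ((g.wz i j : ℤ) : ℝ) / SC)
    (hcov : ∀ b ∈ (Fintype.piFinset fun _ : Fin 3 => Finset.Icc (-7 : ℤ) 7).filter (fun b => b ≠ 0),
      (∃ l ∈ labs, l.toLab = b ∨ l.toLab = -b) ∨ 9 / 2 ≤ ‖latPt G f b‖)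
    (hstop : ∀ l ∈ labs, l ∉ visited nstop labs → 9 / 2 ≤ ‖latPt G f l.toLab‖) :
    ((sgnZ sμ aμ : ℤ) : ℝ) / SC ≤
      ∑ b ∈ (Fintype.piFinset fun _ : Fin 3 => Finset.Icc (-7 : ℤ) 7).filter (fun b => b ≠ 0), effPot w₄₅ ω₄ (3 / 400) ‖latPt G f b‖ := by
  classical
  have hS := SC_pos
  unfold leafCheck at h
  obtain ⟨hokA, hle⟩ := final_true h
  obtain ⟨hall, eV, eD, eS, e0, e1, e2, e3, e4, e5, eC⟩ := acc_sums hokA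
  set k := g.toLK with hk
  set a := foldNL tab k nstop acc0 labs with ha
  set T := (visited nstop labs).filter (fun l => treated tab k l) with hT
  have hTsub : T.Sublist labs := List.filter_sublist.trans (visited_sublist nstop labs)
  have hTmem : ∀ l ∈ T, l ∈ labs := fun l hl => hTsub.subset hl
  have hTt : ∀ l ∈ T, treated tab k l = true := fun l hl => (List.mem_filter.1 hl).2
  have hTnd : T.Nodup := (hnd.of_map _).sublist hTsub
  set S : Finset NL := T.toFinset with hSdef
  have hmemS : ∀ l, l ∈ S ↔ l ∈ T := fun l => List.mem_toFinset
  -- per-record facts for treated labels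
  have hF : ∀ l ∈ S, qNeg k l + rad k l ≤ qPos k l ∧ (rowT tab k l).A ≤ q0N k l - rad k l ∧ q0N k l + rad k l ≤ (rowT tab k l).B ∧
      (rowT tab k l).t ≤ q0N k l ∧ (rowT tab k l).ok E = true := fun l hl => treated_facts htab (hTt l ((hmemS l).1 hl))
  -- real data
  let Lf : NL → Fin 9 → ℝ := fun l k9 => (l.toLab ((@finProdFinEquiv 3 3).symm k9).1 : ℝ) * (l.toLab ((@finProdFinEquiv 3 3).symm k9).2 : ℝ)
  let c0f : Fin 9 → ℝ := fun k9 => ((g.cz ((@finProdFinEquiv 3 3).symm k9).1 ((@finProdFinEquiv 3 3).symm k9).2 : ℤ) : ℝ) / SC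
  let wf : Fin 9 → ℝ := fun k9 => ((g.wz ((@finProdFinEquiv 3 3).symm k9).1 ((@finProdFinEquiv 3 3).symm k9).2 : ℤ) : ℝ) / SC
  let cf : Fin 9 → ℝ := fun k9 => ⟪G (f ((@finProdFinEquiv 3 3).symm k9).1), G (f ((@finProdFinEquiv 3 3).symm k9).2)⟫
  -- δ in ℕ is exact: q0N = qPos − qNeg ≥ t
  have hdlt : ∀ l ∈ S, (((dlt tab k l : ℕ) : ℤ) : ℝ) = ((((qPos k l : ℕ) : ℤ) - ((qNeg k l : ℕ) : ℤ) : ℤ) : ℝ) - (((rowT tab k l).t : ℤ) : ℝ) := by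
    intro l hl
    obtain ⟨h1, -, -, h4, -⟩ := hF l hl
    have hq : qNeg k l ≤ qPos k l := le_trans (Nat.le_add_right _ _) h1
    unfold dlt q0N
    have e : ((qPos k l - qNeg k l - (rowT tab k l).t : ℕ) : ℤ) = (qPos k l : ℤ) - (qNeg k l : ℤ) - ((rowT tab k l).t : ℤ) := by
      unfold q0N at h4; omega
    exact_mod_cast e
  -- centre value and radius in real Gram coordinates
  have hell0 : ∀ l ∈ S, ∑ k9, Lf l k9 * c0f k9 = ((((qPos k l : ℕ) : ℤ) - ((qNeg k l : ℕ) : ℤ) : ℤ) : ℝ) / SC :=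
    fun l hl => ell0_eq (hok l (hTmem l ((hmemS l).1 hl))) g
  have hrad : ∀ l ∈ S, ∑ k9, |Lf l k9| * wf k9 = (((rad k l : ℕ) : ℤ) : ℝ) / SC :=
    fun l hl => rad_real_eq (hok l (hTmem l ((hmemS l).1 hl))) g
  -- row semantics for treated labels
  have RS : ∀ l ∈ S, _ := fun l hl => Row.ok_sound (hF l hl).2.2.2.2
  -- the points-form bound over S
  have hmain := leaf_sound_points S Lf (fun _ q => effPot w₄₅ ω₄ (3 / 400) (Real.sqrt q))
    (fun _ t => deriv (effPot w₄₅ ω₄ (3 / 400)) (Real.sqrt t) / (2 * Real.sqrt t))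
    (fun l => (((rowT tab k l).A : ℤ) : ℝ) / SC) (fun l => (((rowT tab k l).B : ℤ) : ℝ) / SC) (fun l => (((rowT tab k l).M : ℤ) : ℝ) / SC)
    (fun l => (((rowT tab k l).t : ℤ) : ℝ) / SC) (fun l => ((sgnZ (rowT tab k l).sV (rowT tab k l).aV : ℤ) : ℝ) / SC)
    (fun l => ((sgnZ (rowT tab k l).sD (rowT tab k l).aD - (E : ℤ) : ℤ) : ℝ) / SC)
    (fun l => ((sgnZ (rowT tab k l).sD (rowT tab k l).aD + (E : ℤ) : ℤ) : ℝ) / SC) c0f wf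
    (((sgnZ sμ aμ : ℤ) : ℝ) / SC / 2)
    (fun k9 => div_nonneg (by exact_mod_cast Nat.zero_le _) hS.le)
    (fun l hl => (RS l hl).2.2.1)
    (fun l hl t ht => hasDerivAt_phi45 (lt_of_lt_of_le (div_pos (by exact_mod_cast (RS l hl).2.2.2.2.1) hS) ht.1))
    (fun l hl => (RS l hl).2.2.2.1)
    (fun l hl => ⟨div_le_div_of_nonneg_right (by exact_mod_cast (RS l hl).2.2.2.2.2.1) hS.le,
      div_le_div_of_nonneg_right (by exact_mod_cast (RS l hl).2.2.2.2.2.2) hS.le⟩)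
    ?hlo ?hhi (fun l hl => (RS l hl).1) (fun l hl => (RS l hl).2.1) ?hcheck cf (fun k9 => hbox _ _)
  case hlo =>
    intro l hl
    rw [hell0 l hl, hrad l hl, ← sub_div]
    refine div_le_div_of_nonneg_right ?_ hS.le
    obtain ⟨h1, h2, -, -, -⟩ := hF l hl
    have hq : qNeg k l ≤ qPos k l := le_trans (Nat.le_add_right _ _) h1
    have : ((rowT tab k l).A : ℤ) ≤ (qPos k l : ℤ) - qNeg k l - rad k l := by unfold q0N at h2; omega
    exact_mod_cast this
  case hhi =>
    intro l hl
    rw [hell0 l hl, hrad l hl, ← add_div]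
    refine div_le_div_of_nonneg_right ?_ hS.le
    obtain ⟨h1, -, h3, -, -⟩ := hF l hl
    have hq : qNeg k l ≤ qPos k l := le_trans (Nat.le_add_right _ _) h1
    have : (qPos k l : ℤ) - qNeg k l + rad k l ≤ ((rowT tab k l).B : ℤ) := by unfold q0N at h3; omega
    exact_mod_cast this
  case hcheck =>
    -- δ' = ℓ₀ − p = dlt/SC ≥ 0
    have hδ : ∀ l ∈ S, ∑ k9, Lf l k9 * c0f k9 - (((rowT tab k l).t : ℤ) : ℝ) / SC = (((dlt tab k l : ℕ) : ℤ) : ℝ) / SC := by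
      intro l hl; rw [hell0 l hl, hdlt l hl, sub_div]
    have hδ0 : ∀ l ∈ S, (0:ℝ) ≤ (((dlt tab k l : ℕ) : ℤ) : ℝ) / SC := fun l _ => div_nonneg (by exact_mod_cast Nat.zero_le _) hS.le
    -- (i) values
    have hSV : ∑ l ∈ S, ((sgnZ (rowT tab k l).sV (rowT tab k l).aV : ℤ) : ℝ) / SC = ((((a.vP : ℕ) : ℤ) - ((a.vN : ℕ) : ℤ) : ℤ) : ℝ) / SC := by
      rw [← Finset.sum_div, hSdef, List.sum_toFinset _ hTnd, cast_list_sum_int, ← eV]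
    -- (ii) centre corrections
    have hSD : ∑ l ∈ S, min ((((sgnZ (rowT tab k l).sD (rowT tab k l).aD - (E : ℤ) : ℤ) : ℝ) / SC) *
          (∑ k9, Lf l k9 * c0f k9 - (((rowT tab k l).t : ℤ) : ℝ) / SC))
        ((((sgnZ (rowT tab k l).sD (rowT tab k l).aD + (E : ℤ) : ℤ) : ℝ) / SC) * (∑ k9, Lf l k9 * c0f k9 - (((rowT tab k l).t : ℤ) : ℝ) / SC)) =
        (((((a.dP : ℕ) : ℤ) - ((a.dN : ℕ) : ℤ) : ℤ) : ℝ) - (E : ℝ) * ((a.sd : ℕ) : ℝ)) / SC ^ 2 := by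
      have hterm : ∀ l ∈ S, min ((((sgnZ (rowT tab k l).sD (rowT tab k l).aD - (E : ℤ) : ℤ) : ℝ) / SC) *
          (∑ k9, Lf l k9 * c0f k9 - (((rowT tab k l).t : ℤ) : ℝ) / SC))
          ((((sgnZ (rowT tab k l).sD (rowT tab k l).aD + (E : ℤ) : ℤ) : ℝ) / SC) * (∑ k9, Lf l k9 * c0f k9 - (((rowT tab k l).t : ℤ) : ℝ) / SC)) =
          (((sgnZ (rowT tab k l).sD (rowT tab k l).aD * (dlt tab k l : ℤ) : ℤ) : ℝ) - (E : ℝ) * ((dlt tab k l : ℕ) : ℝ)) / SC ^ 2 := by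
        intro l hl
        rw [hδ l hl, min_eq_left (mul_le_mul_of_nonneg_right (div_le_div_of_nonneg_right (by push_cast; linarith) hS.le) (hδ0 l hl))]
        push_cast; field_simp
      rw [Finset.sum_congr rfl hterm, ← Finset.sum_div, Finset.sum_sub_distrib, ← Finset.mul_sum, hSdef, List.sum_toFinset _ hTnd,
        List.sum_toFinset _ hTnd, cast_list_sum_int, cast_list_sum_nat, ← eD, ← eS]
    -- (iv) curvature
    have hSC : ∑ l ∈ S, (((rowT tab k l).M : ℤ) : ℝ) / SC * (|∑ k9, Lf l k9 * c0f k9 - (((rowT tab k l).t : ℤ) : ℝ) / SC| + ∑ k9, |Lf l k9| * wf k9) ^ 2 =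
        ((a.cur : ℕ) : ℝ) / SC ^ 3 := by
      have hterm : ∀ l ∈ S, (((rowT tab k l).M : ℤ) : ℝ) / SC * (|∑ k9, Lf l k9 * c0f k9 - (((rowT tab k l).t : ℤ) : ℝ) / SC| + ∑ k9, |Lf l k9| * wf k9) ^ 2 =
          (((rowT tab k l).M * ((dlt tab k l + rad k l) * (dlt tab k l + rad k l)) : ℕ) : ℝ) / SC ^ 3 := by
        intro l hl
        rw [hδ l hl, hrad l hl, abs_of_nonneg (hδ0 l hl)]
        push_cast; field_simp
      rw [Finset.sum_congr rfl hterm, ← Finset.sum_div, hSdef, List.sum_toFinset _ hTnd, cast_list_sum_nat, ← eC]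
    -- (iii) gradient classes
    have hsub : ∀ (m : NL → ℕ), (T.map m).sum ≤ (labs.map m).sum := fun m => (hTsub.map m).sum_le_sum (fun _ _ => Nat.zero_le _)
    have hLc : ∀ l ∈ T, ∀ i j : Fin 3, (l.toLab i : ℝ) * (l.toLab j : ℝ) =
        ((( ![![(l.m00 : ℤ), sgnZ l.s01 l.m01, sgnZ l.s02 l.m02], ![sgnZ l.s01 l.m01, (l.m11 : ℤ), sgnZ l.s12 l.m12],
          ![sgnZ l.s02 l.m02, sgnZ l.s12 l.m12, (l.m22 : ℤ)]] i j : ℤ)) : ℝ) := by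
      intro l hl i j; rw [← lab_mul_eq (hok l (hTmem l hl))]; push_cast; rfl
    -- the nine coordinates, class by class (literal indices)
    have c00 := class_bound (tab := tab) (k := k) (E := E) T hTnd (fun l => (l.toLab 0 : ℝ) * (l.toLab 0 : ℝ)) (fun l => (l.m00 : ℤ)) NL.m00
      a.g0P a.g0N A0 (fun l hl => by rw [hLc l hl]; simp) (fun l => by simp) e0 ((hsub _).trans hA.1)
    have c11 := class_bound (tab := tab) (k := k) (E := E) T hTnd (fun l => (l.toLab 1 : ℝ) * (l.toLab 1 : ℝ)) (fun l => (l.m11 : ℤ)) NL.m11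
      a.g1P a.g1N A1 (fun l hl => by rw [hLc l hl]; simp) (fun l => by simp) e1 ((hsub _).trans hA.2.1)
    have c22 := class_bound (tab := tab) (k := k) (E := E) T hTnd (fun l => (l.toLab 2 : ℝ) * (l.toLab 2 : ℝ)) (fun l => (l.m22 : ℤ)) NL.m22
      a.g2P a.g2N A2 (fun l hl => by rw [hLc l hl]; simp) (fun l => by simp) e2 ((hsub _).trans hA.2.2.1)
    have c01 := class_bound (tab := tab) (k := k) (E := E) T hTnd (fun l => (l.toLab 0 : ℝ) * (l.toLab 1 : ℝ)) (fun l => sgnZ l.s01 l.m01) NL.m01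
      a.g3P a.g3N A3 (fun l hl => by rw [hLc l hl]; simp) (fun l => abs_sgnZ _ _) e3 ((hsub _).trans hA.2.2.2.1)
    have c10 := class_bound (tab := tab) (k := k) (E := E) T hTnd (fun l => (l.toLab 1 : ℝ) * (l.toLab 0 : ℝ)) (fun l => sgnZ l.s01 l.m01) NL.m01
      a.g3P a.g3N A3 (fun l hl => by rw [hLc l hl]; simp) (fun l => abs_sgnZ _ _) e3 ((hsub _).trans hA.2.2.2.1)
    have c02 := class_bound (tab := tab) (k := k) (E := E) T hTnd (fun l => (l.toLab 0 : ℝ) * (l.toLab 2 : ℝ)) (fun l => sgnZ l.s02 l.m02) NL.m02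
      a.g4P a.g4N A4 (fun l hl => by rw [hLc l hl]; simp) (fun l => abs_sgnZ _ _) e4 ((hsub _).trans hA.2.2.2.2.1)
    have c20 := class_bound (tab := tab) (k := k) (E := E) T hTnd (fun l => (l.toLab 2 : ℝ) * (l.toLab 0 : ℝ)) (fun l => sgnZ l.s02 l.m02) NL.m02
      a.g4P a.g4N A4 (fun l hl => by rw [hLc l hl]; simp) (fun l => abs_sgnZ _ _) e4 ((hsub _).trans hA.2.2.2.2.1)
    have c12 := class_bound (tab := tab) (k := k) (E := E) T hTnd (fun l => (l.toLab 1 : ℝ) * (l.toLab 2 : ℝ)) (fun l => sgnZ l.s12 l.m12) NL.m12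
      a.g5P a.g5N A5 (fun l hl => by rw [hLc l hl]; simp) (fun l => abs_sgnZ _ _) e5 ((hsub _).trans hA.2.2.2.2.2)
    have c21 := class_bound (tab := tab) (k := k) (E := E) T hTnd (fun l => (l.toLab 2 : ℝ) * (l.toLab 1 : ℝ)) (fun l => sgnZ l.s12 l.m12) NL.m12
      a.g5P a.g5N A5 (fun l hl => by rw [hLc l hl]; simp) (fun l => abs_sgnZ _ _) e5 ((hsub _).trans hA.2.2.2.2.2)
    have hw0 : ∀ i j : Fin 3, (0:ℝ) ≤ ((g.wz i j : ℤ) : ℝ) / SC := fun i j => div_nonneg (by exact_mod_cast Nat.zero_le _) hS.le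
    have hSG : ∑ k9, max |∑ l ∈ S, min ((((sgnZ (rowT tab k l).sD (rowT tab k l).aD - (E : ℤ) : ℤ) : ℝ) / SC) * Lf l k9)
            ((((sgnZ (rowT tab k l).sD (rowT tab k l).aD + (E : ℤ) : ℤ) : ℝ) / SC) * Lf l k9)|
          |∑ l ∈ S, max ((((sgnZ (rowT tab k l).sD (rowT tab k l).aD - (E : ℤ) : ℤ) : ℝ) / SC) * Lf l k9)
            ((((sgnZ (rowT tab k l).sD (rowT tab k l).aD + (E : ℤ) : ℤ) : ℝ) / SC) * Lf l k9)| * wf k9 ≤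
        ((gradPen E A0 A1 A2 A3 A4 A5 k a : ℕ) : ℝ) / SC ^ 2 := by
      rw [sum_fin9 (fun i j => max |∑ l ∈ S, min ((((sgnZ (rowT tab k l).sD (rowT tab k l).aD - (E : ℤ) : ℤ) : ℝ) / SC) * ((l.toLab i : ℝ) * (l.toLab j : ℝ)))
            ((((sgnZ (rowT tab k l).sD (rowT tab k l).aD + (E : ℤ) : ℤ) : ℝ) / SC) * ((l.toLab i : ℝ) * (l.toLab j : ℝ)))|
          |∑ l ∈ S, max ((((sgnZ (rowT tab k l).sD (rowT tab k l).aD - (E : ℤ) : ℤ) : ℝ) / SC) * ((l.toLab i : ℝ) * (l.toLab j : ℝ)))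
            ((((sgnZ (rowT tab k l).sD (rowT tab k l).aD + (E : ℤ) : ℤ) : ℝ) / SC) * ((l.toLab i : ℝ) * (l.toLab j : ℝ)))| * (((g.wz i j : ℤ) : ℝ) / SC))]
      simp only [Fin.sum_univ_three]
      rw [hSdef] at *
      have t00 := mul_le_mul_of_nonneg_right c00 (hw0 0 0)
      have t01 := mul_le_mul_of_nonneg_right c01 (hw0 0 1)
      have t02 := mul_le_mul_of_nonneg_right c02 (hw0 0 2)
      have t10 := mul_le_mul_of_nonneg_right c10 (hw0 1 0)
      have t11 := mul_le_mul_of_nonneg_right c11 (hw0 1 1)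
      have t12 := mul_le_mul_of_nonneg_right c12 (hw0 1 2)
      have t20 := mul_le_mul_of_nonneg_right c20 (hw0 2 0)
      have t21 := mul_le_mul_of_nonneg_right c21 (hw0 2 1)
      have t22 := mul_le_mul_of_nonneg_right c22 (hw0 2 2)
      have hgp : ((gradPen E A0 A1 A2 A3 A4 A5 k a : ℕ) : ℝ) / SC ^ 2 =
          ((absDiff a.g0P a.g0N + E * A0 : ℕ) : ℝ) / SC * (((g.wz 0 0 : ℤ) : ℝ) / SC) +
          ((absDiff a.g3P a.g3N + E * A3 : ℕ) : ℝ) / SC * (((g.wz 0 1 : ℤ) : ℝ) / SC) +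
          ((absDiff a.g4P a.g4N + E * A4 : ℕ) : ℝ) / SC * (((g.wz 0 2 : ℤ) : ℝ) / SC) +
          (((absDiff a.g3P a.g3N + E * A3 : ℕ) : ℝ) / SC * (((g.wz 1 0 : ℤ) : ℝ) / SC) +
          ((absDiff a.g1P a.g1N + E * A1 : ℕ) : ℝ) / SC * (((g.wz 1 1 : ℤ) : ℝ) / SC) +
          ((absDiff a.g5P a.g5N + E * A5 : ℕ) : ℝ) / SC * (((g.wz 1 2 : ℤ) : ℝ) / SC)) +
          (((absDiff a.g4P a.g4N + E * A4 : ℕ) : ℝ) / SC * (((g.wz 2 0 : ℤ) : ℝ) / SC) +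
          ((absDiff a.g5P a.g5N + E * A5 : ℕ) : ℝ) / SC * (((g.wz 2 1 : ℤ) : ℝ) / SC) +
          ((absDiff a.g2P a.g2N + E * A2 : ℕ) : ℝ) / SC * (((g.wz 2 2 : ℤ) : ℝ) / SC)) := by
        simp only [gradPen, GB.wz, hk, GB.toLK, Nat.add_eq, Nat.mul_eq, Matrix.cons_val_zero, Matrix.cons_val_one, Matrix.cons_val_two,
          Matrix.head_cons, Matrix.tail_cons]
        push_cast
        field_simp
        ring
      rw [hgp]
      linarith [t00, t01, t02, t10, t11, t12, t20, t21, t22]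
    -- (v) the integer inequality, scaled
    have hX : ((addP sμ aμ 0 : ℕ) : ℝ) - ((addN sμ aμ 0 : ℕ) : ℝ) = ((sgnZ sμ aμ : ℤ) : ℝ) := by exact_mod_cast addP_sub_addN sμ aμ
    have hleR : ((lhs E (addP sμ aμ 0) (gradPen E A0 A1 A2 A3 A4 A5 k a) a : ℕ) : ℝ) ≤ ((rhs (addN sμ aμ 0) a : ℕ) : ℝ) := by exact_mod_cast hle
    unfold lhs rhs at hleR
    simp only [Nat.add_eq, Nat.mul_eq, SCN_eq] at hleR
    push_cast at hleR
    have key : ((sgnZ sμ aμ : ℤ) : ℝ) * (SC : ℝ) ^ 2 ≤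
        2 * (((((a.vP : ℕ) : ℤ) - ((a.vN : ℕ) : ℤ) : ℤ) : ℝ) * (SC : ℝ) ^ 2 +
          ((((((a.dP : ℕ) : ℤ) - ((a.dN : ℕ) : ℤ) : ℤ) : ℝ)) - (E : ℝ) * ((a.sd : ℕ) : ℝ)) * SC -
          ((gradPen E A0 A1 A2 A3 A4 A5 k a : ℕ) : ℝ) * SC) - ((a.cur : ℕ) : ℝ) := by
      rw [← hX]; push_cast; nlinarith [hleR]
    have key' : ((sgnZ sμ aμ : ℤ) : ℝ) / SC / 2 ≤ ((((a.vP : ℕ) : ℤ) - ((a.vN : ℕ) : ℤ) : ℤ) : ℝ) / SC +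
        ((((((a.dP : ℕ) : ℤ) - ((a.dN : ℕ) : ℤ) : ℤ) : ℝ)) - (E : ℝ) * ((a.sd : ℕ) : ℝ)) / SC ^ 2 -
        ((gradPen E A0 A1 A2 A3 A4 A5 k a : ℕ) : ℝ) / SC ^ 2 - 1 / 2 * (((a.cur : ℕ) : ℝ) / SC ^ 3) := by
      have h3 : (0:ℝ) < 2 * (SC : ℝ) ^ 3 := by positivity
      have := div_le_div_of_nonneg_right key h3.le
      calc ((sgnZ sμ aμ : ℤ) : ℝ) / SC / 2 = ((sgnZ sμ aμ : ℤ) : ℝ) * (SC : ℝ) ^ 2 / (2 * (SC : ℝ) ^ 3) := by field_simp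
        _ ≤ _ := this
        _ = _ := by field_simp
    rw [hSV, hSD, hSC]
    linarith [hSG, key']
  -- from the S-sum to the box sum
  have hsumS : ∑ l ∈ S, effPot w₄₅ ω₄ (3 / 400) (Real.sqrt (∑ k9, Lf l k9 * cf k9)) = ∑ l ∈ S, effPot w₄₅ ω₄ (3 / 400) ‖latPt G f l.toLab‖ := by
    refine Finset.sum_congr rfl fun l _ => ?_
    have e := summand_eq_gram (effPot w₄₅ ω₄ (3 / 400)) G f l.toLab
    exact e.symm
  rw [hsumS] at hmain
  -- the image set of labels
  have hinj : Set.InjOn NL.toLab ↑S := by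
    intro l hl l' hl' hll
    have hl1 : l ∈ labs := hTmem l ((hmemS l).1 hl)
    have hl2 : l' ∈ labs := hTmem l' ((hmemS l').1 hl')
    exact (List.inj_on_of_nodup_map hnd) hl1 hl2 hll
  have himg : ∑ b ∈ S.image NL.toLab, effPot w₄₅ ω₄ (3 / 400) ‖latPt G f b‖ = ∑ l ∈ S, effPot w₄₅ ω₄ (3 / 400) ‖latPt G f l.toLab‖ :=
    Finset.sum_image hinj
  have hfold := sum_box7_eq_two_mul_sum (S.image NL.toLab) (fun b => effPot w₄₅ ω₄ (3 / 400) ‖latPt G f b‖)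
    (fun b hb => by
      obtain ⟨l, hl, rfl⟩ := Finset.mem_image.1 hb
      exact hbox7 l (hTmem l ((hmemS l).1 hl)))
    (fun b hb hnb => by
      obtain ⟨l, hl, rfl⟩ := Finset.mem_image.1 hb
      obtain ⟨l', hl', hll'⟩ := Finset.mem_image.1 hnb
      exact hcanon l (hTmem l ((hmemS l).1 hl)) l' (hTmem l' ((hmemS l').1 hl')) (by simp [hll']))
    (fun b => by rw [norm_latPt_neg])
    (fun b hb h1 h2 => by
      refine effPot45_eq_far ?_
      rcases hcov b hb with ⟨l, hl, hlb⟩ | hfar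
      · -- a list label: not visited (far by the stop), or visited: treated (then in S: contradiction) or far by the box
        by_cases hv : l ∈ visited nstop labs
        · have hs := hall l hv
          by_cases ht : treated tab k l = true
          · have hlS : l ∈ S := (hmemS l).2 (List.mem_filter.2 ⟨hv, by simpa using ht⟩)
            rcases hlb with hlb | hlb
            · exact absurd (Finset.mem_image.2 ⟨l, hlS, hlb⟩) h1
            · exact absurd (Finset.mem_image.2 ⟨l, hlS, by simp [hlb]⟩) h2
          · obtain ⟨hq, hfb⟩ := farB_of_untreated hs (by simpa using ht)
            have := far_of_farB hk (hok l hl) hq hfb f G hbox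
            rcases hlb with hlb | hlb
            · rwa [hlb] at this
            · rw [← norm_latPt_neg, ← hlb] ; exact this
        · have := hstop l hl hv
          rcases hlb with hlb | hlb
          · rwa [hlb] at this
          · rw [← norm_latPt_neg, ← hlb]; exact this
      · exact hfar)
  rw [hfold, himg]
  linarith

end Summit.AtomisticToContinuum.Crystallization.Theorems.FrustratedLawDichotomyStrainedPatchHomLeafTableCheck

end
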